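import Literature.Analysis.Complex.HolomorphicParametricIntegral
import Literature.Analysis.Complex.StripWeakBoundaryExceptional
import HarnessLib

/-!
# Mollification in `re w` of a holomorphic function on a strip: continuity up to the boundary

For `u` holomorphic on `S = {0 < im w < 1}` with `‖u(x + iy)‖ ≤ C y^{-p}(1 - y)^{-p} e^{a|x|}`, `0 ≤ p < 1`,
and a smooth compactly supported real `φ`, the mollification `u_φ(w) = ∫ u(w + t) φ(t) dt` is

* holomorphic on `S` (`differentiableOn_stripMollify`; the tree's holomorphy of dominated parameter integrals,
  `differentiableOn_integral_of_dominated`);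
* on horizontal lines the pairing of `u` with the translates of `φ`
  (`stripMollify_eq_pairing`: `u_φ(x + iy) = ∫ u(s + iy) φ(s - x) ds`);
* continuous up to the bottom line, with boundary values `g(x) = lim_{y → 0⁺} u_φ(x + iy)` attained locally
  uniformly at rate `y^{1-p}` (`norm_stripPairing_sub_lim_le` of `StripWeakBoundaryPairing.lean`, uniform
  over translates), and bounded by `K e^{a|re w|}` on `{0 ≤ im w ≤ 1/2}` (`stripMollify_boundary`).

This is the regularisation step of the weak strip-rigidity theorem
(`Literature/Analysis/Complex/StripPositivityRigidityWeak.lean`). All statements are folklore (cf. the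
regularisation `F_f(z) = ∫ f(x - ξ) F(ξ + iy) dξ` in Streater–Wightman, *PCT, Spin and Statistics, and All
That*, proof of Thm. 2-16).
-/

noncomputable section

namespace Literature.Analysis.Complex

open _root_.Complex Set Filter Metric MeasureTheory
open scoped Topology Real

/-! ### Mollification in `re w` -/

/-- The mollification `u_φ(w) = ∫ u(w + t) φ(t) dt` on horizontal lines is the pairing of `u` with the
translates of `φ`: `u_φ(x + iy) = ∫ u(s + iy) φ(s - x) ds`. [folklore] -/
theorem stripMollify_eq_pairing (u : ℂ → ℂ) (φ : ℝ → ℝ) (x y : ℝ) :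
    (∫ t : ℝ, u ((x : ℂ) + y * I + t) * (φ t : ℂ)) = ∫ s : ℝ, u (s + y * I) * (φ (s - x) : ℂ) := by
  have := integral_add_right_eq_self (μ := volume) (fun s : ℝ => u (s + y * I) * (φ (s - x) : ℂ)) x
  rw [← this]
  congr 1; funext t
  congr 2
  · push_cast; ring
  · simp

/-- The translate `s ↦ φ(s - x)` of a smooth compactly supported real function, as a complex test function:
smooth, supported in `[-(|x| + R), |x| + R]` when `φ` is supported in `[-R, R]`, with the same `L¹` norm of the
derivative. [folklore] -/
theorem translate_test_function {φ : ℝ → ℝ} (hφ : ContDiff ℝ (⊤ : ℕ∞) φ) {R : ℝ}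
    (hφR : tsupport φ ⊆ Icc (-R) R) (x : ℝ) :
    ContDiff ℝ (⊤ : ℕ∞) (fun s : ℝ => (φ (s - x) : ℂ)) ∧
      tsupport (fun s : ℝ => (φ (s - x) : ℂ)) ⊆ Icc (-(|x| + R)) (|x| + R) ∧
      HasCompactSupport (fun s : ℝ => (φ (s - x) : ℂ)) ∧
      (∫ s : ℝ, ‖deriv (fun s : ℝ => (φ (s - x) : ℂ)) s‖) = ∫ s : ℝ, ‖deriv φ s‖ := by
  have hsmooth : ContDiff ℝ (⊤ : ℕ∞) (fun s : ℝ => (φ (s - x) : ℂ)) :=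
    ofRealCLM.contDiff.comp (hφ.comp (contDiff_id.sub contDiff_const))
  have hts : tsupport (fun s : ℝ => (φ (s - x) : ℂ)) ⊆ Icc (-(|x| + R)) (|x| + R) := by
    refine closure_minimal ?_ isClosed_Icc
    intro s hs
    have hs' : φ (s - x) ≠ 0 := by simpa using hs
    have hmem : s - x ∈ Icc (-R) R := hφR (subset_tsupport _ hs')
    constructor
    · linarith [hmem.1, neg_abs_le x]
    · linarith [hmem.2, le_abs_self x]
  refine ⟨hsmooth, hts, IsCompact.of_isClosed_subset isCompact_Icc (isClosed_tsupport _) hts, ?_⟩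
  have hderiv : ∀ s, deriv (fun s : ℝ => (φ (s - x) : ℂ)) s = ((deriv φ (s - x) : ℝ) : ℂ) := by
    intro s
    have h1 : deriv (fun s : ℝ => (φ (s - x) : ℂ)) s = deriv (fun t : ℝ => (φ t : ℂ)) (s - x) :=
      deriv_comp_sub_const (f := fun t : ℝ => (φ t : ℂ)) (a := x) (x := s)
    rw [h1]
    exact ((hφ.differentiable (by simp)).differentiableAt.hasDerivAt.ofReal_comp).deriv
  simp_rw [hderiv, Complex.norm_real]
  exact integral_sub_right_eq_self (μ := volume) (fun s => ‖deriv φ s‖) x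

/-- **The mollification `u_φ(w) = ∫ u(w + t) φ(t) dt` is holomorphic** on the open strip (holomorphic
dependence of dominated parameter integrals, the tree's `differentiableOn_integral_of_dominated`; the local
majorant comes from continuity of `u` on the compact set `closedBall w₀ r + tsupport φ ⊆ S`). [folklore] -/
theorem differentiableOn_stripMollify {u : ℂ → ℂ}
    (hd : DifferentiableOn ℂ u {w : ℂ | 0 < w.im ∧ w.im < 1})
    {φ : ℝ → ℝ} (hφ : ContDiff ℝ (⊤ : ℕ∞) φ) (hφc : HasCompactSupport φ) :
    DifferentiableOn ℂ (fun w : ℂ => ∫ t : ℝ, u (w + t) * (φ t : ℂ)) {w : ℂ | 0 < w.im ∧ w.im < 1} := by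
  set S : Set ℂ := {w : ℂ | 0 < w.im ∧ w.im < 1} with hS
  have hSo : IsOpen S := (isOpen_Ioo (a := (0:ℝ)) (b := 1)).preimage continuous_im
  have hφcont : Continuous φ := hφ.continuous
  have hmem : ∀ w ∈ S, ∀ t : ℝ, w + (t : ℂ) ∈ S := fun w hw t => by simpa [hS] using hw
  refine differentiableOn_integral_of_dominated (μ := volume) (fun w hw => ?_)
    (Filter.Eventually.of_forall fun t => ?_) (fun w₀ hw₀ => ?_)
  · -- measurability: the integrand is continuous in `t`
    refine (Continuous.mul ?_ (continuous_ofReal.comp hφcont)).aestronglyMeasurable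
    exact hd.continuousOn.comp_continuous (continuous_const.add continuous_ofReal) (hmem w hw)
  · -- holomorphy in `w`
    exact (hd.comp (differentiableOn_id.add_const _) (fun w hw => hmem w hw t)).mul_const _
  · -- local majorant
    obtain ⟨r, hr, hrS⟩ : ∃ r > 0, closedBall w₀ r ⊆ S := by
      obtain ⟨ε, hε, hεS⟩ := Metric.isOpen_iff.mp hSo w₀ hw₀
      exact ⟨ε / 2, by positivity, (closedBall_subset_ball (by linarith)).trans hεS⟩
    set K : Set ℂ := (fun q : ℂ × ℝ => q.1 + (q.2 : ℂ)) '' (closedBall w₀ r ×ˢ tsupport φ) with hK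
    have hKc : IsCompact K :=
      ((isCompact_closedBall w₀ r).prod hφc).image (by fun_prop)
    have hKS : K ⊆ S := by
      rintro _ ⟨⟨w, t⟩, ⟨hw, -⟩, rfl⟩
      exact hmem w (hrS hw) t
    obtain ⟨M, hM⟩ := hKc.exists_bound_of_continuousOn (hd.continuousOn.mono hKS)
    refine ⟨r, hr, ball_subset_closedBall.trans hrS, fun t => M * ‖(φ t : ℂ)‖, ?_, ?_⟩
    · exact ((continuous_ofReal.comp hφcont).norm.const_mul M).integrable_of_hasCompactSupport
        ((hφc.comp_left (g := fun r : ℝ => (r : ℂ)) rfl).norm.mul_left)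
    · refine Filter.Eventually.of_forall fun t w hw => ?_
      rw [norm_mul]
      by_cases ht : t ∈ tsupport φ
      · exact mul_le_mul_of_nonneg_right (hM _ ⟨⟨w, t⟩, ⟨ball_subset_closedBall hw, ht⟩, rfl⟩)
          (norm_nonneg _)
      · have : φ t = 0 := image_eq_zero_of_notMem_tsupport ht
        simp [this]

/-- **Boundary behaviour of the mollification at the bottom line.** For `u` holomorphic on the strip with
`‖u‖ ≤ C y^{-p}(1-y)^{-p} e^{a|x|}`, `p < 1`, and a smooth compactly supported real `φ`, the mollification
`u_φ(w) = ∫ u(w + t) φ(t) dt` has boundary values `g(x) = lim_{y→0⁺} u_φ(x + iy)` at every real `x`, attained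
locally uniformly at rate `y^{1-p}`; the function equal to `u_φ` on `{0 < im < 1}` and to `g ∘ re` on the real
axis is continuous on `{0 ≤ im < 1}` and bounded by `K e^{a|re w|}` on `{0 ≤ im ≤ 1/2}`. [folklore] -/
theorem stripMollify_boundary {u : ℂ → ℂ} {C a p : ℝ} (hC : 0 ≤ C) (ha : 0 ≤ a) (hp : 0 ≤ p)
    (hp1 : p < 1)
    (hd : DifferentiableOn ℂ u {w : ℂ | 0 < w.im ∧ w.im < 1})
    (hb : ∀ w : ℂ, 0 < w.im → w.im < 1 →
      ‖u w‖ ≤ C * w.im ^ (-p) * (1 - w.im) ^ (-p) * Real.exp (a * |w.re|))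
    {φ : ℝ → ℝ} (hφ : ContDiff ℝ (⊤ : ℕ∞) φ) (hφc : HasCompactSupport φ) :
    ∃ g : ℝ → ℂ,
      (∀ x : ℝ, Tendsto (fun y : ℝ => ∫ s : ℝ, u (s + y * I) * (φ (s - x) : ℂ)) (𝓝[>] 0) (𝓝 (g x))) ∧
      ContinuousOn (fun w : ℂ => if 0 < w.im then ∫ t : ℝ, u (w + t) * (φ t : ℂ) else g w.re)
        {w : ℂ | 0 ≤ w.im ∧ w.im < 1} ∧
      ∃ K : ℝ, ∀ w : ℂ, 0 ≤ w.im → w.im ≤ 1 / 2 →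
        ‖(if 0 < w.im then ∫ t : ℝ, u (w + t) * (φ t : ℂ) else g w.re)‖ ≤ K * Real.exp (a * |w.re|) := by
  set S : Set ℂ := {w : ℂ | 0 < w.im ∧ w.im < 1} with hS
  have hSo : IsOpen S := (isOpen_Ioo (a := (0:ℝ)) (b := 1)).preimage continuous_im
  obtain ⟨R, hR⟩ : ∃ R : ℝ, tsupport φ ⊆ Icc (-R) R := by
    obtain ⟨R, hR⟩ := hφc.isCompact.isBounded.subset_closedBall 0
    exact ⟨R, fun x hx => by simpa [Real.closedBall_eq_Icc] using hR hx⟩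
  set N : ℝ := ∫ s : ℝ, ‖deriv φ s‖ with hN
  have hψ := fun x : ℝ => translate_test_function hφ hR x
  -- the pairings `Φ x y = ∫ u(s + iy) φ(s - x) ds = u_φ(x + iy)`
  set Φ : ℝ → ℝ → ℂ := fun x y => ∫ s : ℝ, u (s + y * I) * (φ (s - x) : ℂ) with hΦ
  have hid : ∀ x y : ℝ, (∫ t : ℝ, u ((x : ℂ) + y * I + t) * (φ t : ℂ)) = Φ x y :=
    fun x y => stripMollify_eq_pairing u φ x y
  -- boundary values
  have hex : ∀ x : ℝ, ∃ ℓ : ℂ, Tendsto (Φ x) (𝓝[>] 0) (𝓝 ℓ) := fun x =>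
    exists_tendsto_stripPairing hC ha hp hp1.le hd hb (hψ x).1 (hψ x).2.2.1
  choose g hg using hex
  -- rate of convergence, locally uniform in `x`
  set K₀ : ℝ := C * 2 ^ p * Real.exp (a * R) * N / (1 - p) with hK₀
  have hK₀nn : 0 ≤ K₀ := by
    have : 0 ≤ N := integral_nonneg fun s => norm_nonneg _
    have : 0 < 1 - p := by linarith
    positivity
  have hrate : ∀ x y : ℝ, 0 < y → y ≤ 1 / 2 →
      ‖Φ x y - g x‖ ≤ K₀ * Real.exp (a * |x|) * y ^ (1 - p) := by
    intro x y hy0 hy1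
    have := norm_stripPairing_sub_lim_le hC ha hp hp1 hd hb (hψ x).1 (hψ x).2.1
      (le_of_eq (hψ x).2.2.2) (hg x) hy0 hy1
    refine this.trans (le_of_eq ?_)
    rw [hK₀, mul_add, Real.exp_add]; ring
  -- continuity of `x ↦ Φ x y` for `0 < y < 1`
  have hcontx : ∀ y : ℝ, 0 < y → y < 1 → Continuous fun x : ℝ => Φ x y := by
    intro y hy0 hy1
    have h := (differentiableOn_stripMollify hd hφ hφc).continuousOn.comp_continuous
      (f := fun x : ℝ => (x : ℂ) + y * I) (by fun_prop) (fun x => by simp [hy0, hy1])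
    refine h.congr fun x => ?_
    simp only [Function.comp_apply]
    exact hid x y
  -- continuity of `g`
  have hgc : Continuous g := by
    rw [Metric.continuous_iff]
    intro x₀ ε hε
    set K₁ : ℝ := K₀ * Real.exp (a * (|x₀| + 1)) with hK₁
    obtain ⟨y, hy0, hy1, hyK⟩ := exists_small_height (K := K₁) (show 0 < ε / 3 by positivity) hp1
    obtain ⟨δ₁, hδ₁, hδ⟩ := Metric.continuous_iff.mp (hcontx y hy0 (by linarith)) x₀ (ε / 3)
      (by positivity)
    refine ⟨min δ₁ 1, by positivity, fun x hx => ?_⟩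
    have hx1 : dist x x₀ < δ₁ := lt_of_lt_of_le hx (min_le_left _ _)
    have hx2 : |x| ≤ |x₀| + 1 := by
      have : |x - x₀| < 1 := by
        rw [← Real.dist_eq]; exact lt_of_lt_of_le hx (min_le_right _ _)
      linarith [abs_sub_abs_le_abs_sub x x₀]
    have hKx : ∀ z : ℝ, |z| ≤ |x₀| + 1 → K₀ * Real.exp (a * |z|) * y ^ (1 - p) ≤ K₁ * y ^ (1 - p) := by
      intro z hz
      refine mul_le_mul_of_nonneg_right ?_ (Real.rpow_nonneg hy0.le _)
      exact mul_le_mul_of_nonneg_left (Real.exp_le_exp.mpr (mul_le_mul_of_nonneg_left hz ha)) hK₀nn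
    calc dist (g x) (g x₀)
        ≤ dist (g x) (Φ x y) + dist (Φ x y) (Φ x₀ y) + dist (Φ x₀ y) (g x₀) := dist_triangle4 _ _ _ _
      _ < ε / 3 + ε / 3 + ε / 3 := by
          gcongr
          · rw [dist_comm, dist_eq_norm]
            exact lt_of_le_of_lt ((hrate x y hy0 hy1).trans (hKx x hx2)) hyK
          · exact hδ x hx1
          · rw [dist_eq_norm]
            exact lt_of_le_of_lt ((hrate x₀ y hy0 hy1).trans (hKx x₀ (by linarith))) hyK
      _ = ε := by ring
  refine ⟨g, hg, ?_, ?_⟩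
  · -- continuity of the extension on `{0 ≤ im < 1}`
    intro w₀ hw₀
    rcases hw₀.1.eq_or_lt with h0 | hpos
    · -- a boundary point
      rw [Metric.continuousWithinAt_iff]
      intro ε hε
      have hU0 : (if 0 < w₀.im then ∫ t : ℝ, u (w₀ + t) * (φ t : ℂ) else g w₀.re) = g w₀.re := by
        rw [if_neg (by rw [← h0]; exact lt_irrefl 0)]
      obtain ⟨δ₁, hδ₁, hgδ⟩ := Metric.continuous_iff.mp hgc w₀.re (ε / 2) (by positivity)
      set K₁ : ℝ := K₀ * Real.exp (a * (|w₀.re| + 1)) with hK₁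
      obtain ⟨η, hη0, hη1, hηK⟩ := exists_small_height (K := K₁) (show 0 < ε / 2 by positivity) hp1
      refine ⟨min δ₁ (min η 1), by positivity, fun w hw hdist => ?_⟩
      have hd1 : dist w w₀ < δ₁ := lt_of_lt_of_le hdist (min_le_left _ _)
      have hd2 : dist w w₀ < η := lt_of_lt_of_le hdist ((min_le_right _ _).trans (min_le_left _ _))
      have hd3 : dist w w₀ < 1 := lt_of_lt_of_le hdist ((min_le_right _ _).trans (min_le_right _ _))
      have hre1 : dist w.re w₀.re < δ₁ :=
        lt_of_le_of_lt (by rw [Real.dist_eq, dist_eq_norm, ← sub_re]; exact abs_re_le_norm _) hd1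
      have hre2 : |w.re| ≤ |w₀.re| + 1 := by
        have : |w.re - w₀.re| < 1 :=
          lt_of_le_of_lt (by rw [dist_eq_norm, ← sub_re]; exact abs_re_le_norm _) hd3
        linarith [abs_sub_abs_le_abs_sub w.re w₀.re]
      have him : w.im < η := by
        have : |w.im - w₀.im| < η :=
          lt_of_le_of_lt (by rw [dist_eq_norm, ← sub_im]; exact abs_im_le_norm _) hd2
        rw [← h0, sub_zero] at this
        exact (abs_lt.mp this).2
      rw [hU0]
      rcases hw.1.eq_or_lt with hw0 | hwpos
      · rw [if_neg (by rw [← hw0]; exact lt_irrefl 0)]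
        exact (hgδ w.re hre1).trans (by linarith)
      · rw [if_pos hwpos]
        have hUw : (∫ t : ℝ, u (w + t) * (φ t : ℂ)) = Φ w.re w.im := by
          rw [← hid w.re w.im, re_add_im]
        rw [hUw]
        calc dist (Φ w.re w.im) (g w₀.re)
            ≤ dist (Φ w.re w.im) (g w.re) + dist (g w.re) (g w₀.re) := dist_triangle _ _ _
          _ < ε / 2 + ε / 2 := by
              gcongr
              · rw [dist_eq_norm]
                calc ‖Φ w.re w.im - g w.re‖
                    ≤ K₀ * Real.exp (a * |w.re|) * w.im ^ (1 - p) := hrate w.re w.im hwpos (by linarith)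
                  _ ≤ K₁ * η ^ (1 - p) := by
                      refine mul_le_mul ?_ ?_ (Real.rpow_nonneg hwpos.le _) (by positivity)
                      · exact mul_le_mul_of_nonneg_left
                          (Real.exp_le_exp.mpr (mul_le_mul_of_nonneg_left hre2 ha)) hK₀nn
                      · exact Real.rpow_le_rpow hwpos.le him.le (by linarith)
                  _ < ε / 2 := hηK
              · exact hgδ w.re hre1
          _ = ε := by ring
    · -- an interior point
      have hwS : w₀ ∈ S := ⟨hpos, hw₀.2⟩
      have hev : (fun w : ℂ => ∫ t : ℝ, u (w + t) * (φ t : ℂ)) =ᶠ[𝓝 w₀]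
          fun w : ℂ => if 0 < w.im then ∫ t : ℝ, u (w + t) * (φ t : ℂ) else g w.re := by
        filter_upwards [hSo.mem_nhds hwS] with w hw
        rw [if_pos hw.1]
      exact (((differentiableOn_stripMollify hd hφ hφc).continuousOn.continuousAt
        (hSo.mem_nhds hwS)).congr hev).continuousWithinAt
  · -- the bound on `{0 ≤ im ≤ 1/2}`
    set A : ℝ := C * 2 ^ p * Real.exp (a * R) * (2:ℝ) ^ p * ∫ s : ℝ, |φ s| with hA
    have hhalf : ∀ x : ℝ, ‖Φ x (1 / 2)‖ ≤ A * Real.exp (a * |x|) := by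
      intro x
      have hint : Integrable (fun s : ℝ => ‖(φ (s - x) : ℂ)‖) :=
        ((hψ x).1.continuous.integrable_of_hasCompactSupport (hψ x).2.2.1).norm
      have h1 : ‖Φ x (1 / 2)‖ ≤ ∫ s : ℝ, C * 2 ^ p * Real.exp (a * (|x| + R)) * (1 / 2 : ℝ) ^ (-p) *
          ‖(φ (s - x) : ℂ)‖ := by
        refine norm_integral_le_of_norm_le (hint.const_mul _) (Filter.Eventually.of_forall fun s => ?_)
        by_cases hs : s ∈ tsupport (fun s : ℝ => (φ (s - x) : ℂ))
        · have hsR : |s| ≤ |x| + R := abs_le.mpr (by simpa using (hψ x).2.1 hs)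
          rw [norm_mul]
          refine mul_le_mul_of_nonneg_right ?_ (norm_nonneg _)
          have := norm_le_of_strip_growth_lower (w := (s : ℂ) + (1 / 2 : ℝ) * I) hC ha hp hb
            (by simp) (by simp) (by simpa using hsR)
          simpa using this
        · have : (fun s : ℝ => (φ (s - x) : ℂ)) s = 0 :=
            image_eq_zero_of_notMem_tsupport (f := fun s : ℝ => (φ (s - x) : ℂ)) hs
          simp only at this
          simp [this]
      refine h1.trans (le_of_eq ?_)
      rw [integral_const_mul]
      have e1 : (∫ s : ℝ, ‖(φ (s - x) : ℂ)‖) = ∫ s : ℝ, |φ s| := by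
        simp_rw [Complex.norm_real, Real.norm_eq_abs]
        exact integral_sub_right_eq_self (μ := volume) (fun s => |φ s|) x
      have e2 : (1 / 2 : ℝ) ^ (-p) = (2:ℝ) ^ p := by
        rw [Real.rpow_neg (by norm_num), one_div, Real.inv_rpow (by norm_num), inv_inv]
      rw [e1, e2, hA, mul_add, Real.exp_add]; ring
    refine ⟨2 * K₀ + A, fun w hw0 hw1 => ?_⟩
    have hgx : ∀ x : ℝ, ‖g x‖ ≤ (K₀ + A) * Real.exp (a * |x|) := by
      intro x
      have h1 := hrate x (1 / 2) (by norm_num) le_rfl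
      have h2 : (1 / 2 : ℝ) ^ (1 - p) ≤ 1 :=
        Real.rpow_le_one (by norm_num) (by norm_num) (by linarith)
      have h3 : K₀ * Real.exp (a * |x|) * (1 / 2 : ℝ) ^ (1 - p) ≤ K₀ * Real.exp (a * |x|) := by
        have : 0 ≤ K₀ * Real.exp (a * |x|) := by positivity
        nlinarith
      calc ‖g x‖ = ‖(g x - Φ x (1 / 2)) + Φ x (1 / 2)‖ := by ring_nf
        _ ≤ ‖g x - Φ x (1 / 2)‖ + ‖Φ x (1 / 2)‖ := norm_add_le _ _
        _ ≤ K₀ * Real.exp (a * |x|) + A * Real.exp (a * |x|) := by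
            rw [norm_sub_rev]; exact add_le_add (h1.trans h3) (hhalf x)
        _ = (K₀ + A) * Real.exp (a * |x|) := by ring
    rcases hw0.eq_or_lt with h0 | hpos
    · rw [if_neg (by rw [← h0]; exact lt_irrefl 0)]
      refine (hgx w.re).trans ?_
      have : 0 ≤ K₀ * Real.exp (a * |w.re|) := by positivity
      nlinarith
    · rw [if_pos hpos]
      have hUw : (∫ t : ℝ, u (w + t) * (φ t : ℂ)) = Φ w.re w.im := by
        rw [← hid w.re w.im, re_add_im]
      rw [hUw]
      have h1 := hrate w.re w.im hpos hw1
      have h2 : w.im ^ (1 - p) ≤ 1 := Real.rpow_le_one hpos.le (by linarith) (by linarith)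
      have h3 : K₀ * Real.exp (a * |w.re|) * w.im ^ (1 - p) ≤ K₀ * Real.exp (a * |w.re|) := by
        have : 0 ≤ K₀ * Real.exp (a * |w.re|) := by positivity
        nlinarith
      calc ‖Φ w.re w.im‖ = ‖(Φ w.re w.im - g w.re) + g w.re‖ := by ring_nf
        _ ≤ ‖Φ w.re w.im - g w.re‖ + ‖g w.re‖ := norm_add_le _ _
        _ ≤ K₀ * Real.exp (a * |w.re|) + (K₀ + A) * Real.exp (a * |w.re|) :=
            add_le_add (h1.trans h3) (hgx w.re)
        _ = (2 * K₀ + A) * Real.exp (a * |w.re|) := by ring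

end Literature.Analysis.Complex
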